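import Literature.AlgebraicGeometry.Frobenioids.BaseCategoryTheoreticity
import HarnessLib

/-!
# Frobenioids I, Theorem 3.4 (iv), the unit-trivialisation square: functoriality of `C ↦ C^un-tr`
# along functors `C₁^istr → C₂^istr` compatible with unit-equivalence (CONSTRUCTION + PROOFS)

Mochizuki, *The geometry of Frobenioids I: the general theory*, Kyushu J. Math. **62** (2008),
Definition 3.1 (iv) p. 57, Proposition 3.3 (iii) p. 59, Theorem 3.4 (iv) p. 63
[cite: MochizukiFrdI2008, Thm. 3.4 (iv) p.63]: "… `Ψ` induces a `1`-unique functor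
`Ψ^un-tr : C₁^un-tr → C₂^un-tr` that fits into a `1`-commutative diagram [with `C_i^istr → C_i^un-tr`]".
With `C^un-tr` the quotient category of `C^istr` by unit-equivalence (seat abc-iut-L1-t3's `PreFrobenioidData.Untr`,
`toUntr`), this is the universal property of the quotient, recorded here in the hypothesis-decoupled form
the typed statement `PreFrobenioidData.Thm34iv_untr` consumes (abc-iut cell PIECES protocol, for seat
abc-iut-L1-t13): the only input is that the functor on `C^istr` carries unit-equivalent pairs to
unit-equivalent pairs (for an equivalence `Ψ` as in Thm. 3.4 (iv) this is "`Ψ` preserves `O^×(-)`").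

* `PreservesUnitEquiv S₁ S₂ Ψ` — the hypothesis;
* `untrMap` — `Ψ^un-tr : C₁^un-tr → C₂^un-tr` (`Quotient.lift`), with `toUntr_comp_untrMap` (the square
  commutes ON THE NOSE), `toUntrCompUntrMapIso`, `oneCommutes_untrMap`;
* `untrMap_unique` — `1`-uniqueness: any `B′` making the square `1`-commute is isomorphic to `Ψ^un-tr`
  (`Quotient.natIsoLift`);
* for an equivalence `E : C₁^istr ≌ C₂^istr` both of whose functors preserve unit-equivalence: `untrEquiv`,
  `untrMap_isEquivalence`, and `oneUniqueSquare_untrMap : OneUniqueSquare E.functor S₁.toUntr S₂.toUntr Ψ^un-tr`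
  — the complete first conjunct of `Thm34iv_untr` (the rigidity conjunct is not treated here).
Purely categorical: no Frobenioid axiom is used.
-/

namespace Literature.AlgebraicGeometry.Frobenioids

namespace PreFrobenioidData

open CategoryTheory

universe w₁ v₁ v₁' u₁ u₁' w₂ v₂ v₂' u₂ u₂'

variable {C₁ : Type u₁} [Category.{v₁} C₁] {D₁ : Type u₁'} [Category.{v₁'} D₁]
variable {C₂ : Type u₂} [Category.{v₂} C₂] {D₂ : Type u₂'} [Category.{v₂'} D₂]
variable (S₁ : PreFrobenioidData.{w₁} C₁ D₁) (S₂ : PreFrobenioidData.{w₂} C₂ D₂)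

/-- A functor `C₁^istr → C₂^istr` *preserves unit-equivalence* if it carries unit-equivalent pairs of
co-objective arrows to unit-equivalent pairs (for `Ψ^istr` of Thm. 3.4 this follows from "`Ψ` preserves
`O^×(-)`", Thm. 3.4 (iv)). [cite: MochizukiFrdI2008, Thm. 3.4 (iv) p.63] -/
def PreservesUnitEquiv (Ψ : S₁.Istr ⥤ S₂.Istr) : Prop :=
  ∀ ⦃A B : S₁.Istr⦄ (α₁ α₂ : A ⟶ B), S₁.UnitEquiv α₁ α₂ → S₂.UnitEquiv (Ψ.map α₁) (Ψ.map α₂)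

variable {S₁ S₂}

section Map

variable {Ψ : S₁.Istr ⥤ S₂.Istr} (hΨ : PreservesUnitEquiv S₁ S₂ Ψ)
include hΨ

/-- **`Ψ^un-tr : C₁^un-tr → C₂^un-tr`**, the functor induced on unit-trivialisations (universal property of
the quotient `C₁^istr → C₁^un-tr`). [cite: MochizukiFrdI2008, Thm. 3.4 (iv) p.63] -/
def untrMap : S₁.Untr ⥤ S₂.Untr :=
  CategoryTheory.Quotient.lift S₁.UnitEquiv (Ψ ⋙ S₂.toUntr)
    fun _ _ α₁ α₂ h => CategoryTheory.Quotient.sound S₂.UnitEquiv (hΨ α₁ α₂ h)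

/-- The square commutes on the nose: `(C₁^istr → C₁^un-tr) ⋙ Ψ^un-tr = Ψ^istr ⋙ (C₂^istr → C₂^un-tr)`.
[cite: MochizukiFrdI2008, Thm. 3.4 (iv) p.63] -/
theorem toUntr_comp_untrMap : S₁.toUntr ⋙ untrMap hΨ = Ψ ⋙ S₂.toUntr :=
  CategoryTheory.Quotient.lift_spec _ _ _

/-- The `1`-commutative square, as a natural isomorphism with identity components.
[cite: MochizukiFrdI2008, Thm. 3.4 (iv) p.63] -/
def toUntrCompUntrMapIso : S₁.toUntr ⋙ untrMap hΨ ≅ Ψ ⋙ S₂.toUntr :=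
  CategoryTheory.Quotient.lift.isLift _ _ _

/-- The square `1`-commutes (in the orientation of `OneUniqueSquare`). [cite: MochizukiFrdI2008, Thm. 3.4 (iv) p.63] -/
theorem oneCommutes_untrMap : OneCommutes Ψ S₂.toUntr S₁.toUntr (untrMap hΨ) :=
  ⟨(toUntrCompUntrMapIso hΨ).symm⟩

/-- **`1`-uniqueness of `Ψ^un-tr`**: any functor `B′ : C₁^un-tr → C₂^un-tr` making the square `1`-commute is
isomorphic to `Ψ^un-tr` (natural isomorphisms of functors out of the quotient are determined after
precomposition with `C₁^istr → C₁^un-tr`). [cite: MochizukiFrdI2008, Thm. 3.4 (iv) p.63] -/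
theorem untrMap_unique (B' : S₁.Untr ⥤ S₂.Untr) (h : OneCommutes Ψ S₂.toUntr S₁.toUntr B') :
    Nonempty (B' ≅ untrMap hΨ) := by
  obtain ⟨e⟩ := h
  exact ⟨CategoryTheory.Quotient.natIsoLift _ (e.symm ≪≫ (toUntrCompUntrMapIso hΨ).symm)⟩

end Map

/-! ### `Ψ^un-tr` is an equivalence when `Ψ^istr` is -/

section Equivalence

variable {E : S₁.Istr ≌ S₂.Istr}

/-- **`C₁^un-tr ≌ C₂^un-tr`** induced by an equivalence `C₁^istr ≌ C₂^istr` both of whose functors preserve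
unit-equivalence: functor `(E.functor)^un-tr`, inverse `(E.inverse)^un-tr`, unit and counit lifted from
those of `E` through the quotient functors. [cite: MochizukiFrdI2008, Thm. 3.4 (iv) p.63] -/
def untrEquiv (h₁ : PreservesUnitEquiv S₁ S₂ E.functor) (h₂ : PreservesUnitEquiv S₂ S₁ E.inverse) :
    S₁.Untr ≌ S₂.Untr :=
  CategoryTheory.Equivalence.mk (untrMap h₁) (untrMap h₂)
    (CategoryTheory.Quotient.natIsoLift _
      (Functor.rightUnitor _ ≪≫ (Functor.leftUnitor _).symm ≪≫ Functor.isoWhiskerRight E.unitIso S₁.toUntr ≪≫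
        Functor.associator _ _ _ ≪≫ Functor.isoWhiskerLeft E.functor (toUntrCompUntrMapIso h₂).symm ≪≫
          (Functor.associator _ _ _).symm ≪≫ Functor.isoWhiskerRight (toUntrCompUntrMapIso h₁).symm (untrMap h₂) ≪≫
            Functor.associator _ _ _))
    (CategoryTheory.Quotient.natIsoLift _
      ((Functor.associator _ _ _).symm ≪≫ Functor.isoWhiskerRight (toUntrCompUntrMapIso h₂) (untrMap h₁) ≪≫
        Functor.associator _ _ _ ≪≫ Functor.isoWhiskerLeft E.inverse (toUntrCompUntrMapIso h₁) ≪≫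
          (Functor.associator _ _ _).symm ≪≫ Functor.isoWhiskerRight E.counitIso S₂.toUntr ≪≫
            Functor.leftUnitor _ ≪≫ (Functor.rightUnitor _).symm))

/-- The functor of `untrEquiv` is `Ψ^un-tr`. [cite: MochizukiFrdI2008, Thm. 3.4 (iv) p.63] -/
theorem untrEquiv_functor (h₁ : PreservesUnitEquiv S₁ S₂ E.functor) (h₂ : PreservesUnitEquiv S₂ S₁ E.inverse) :
    (untrEquiv h₁ h₂).functor = untrMap h₁ :=
  rfl

/-- **`Ψ^un-tr` is an equivalence of categories.** [cite: MochizukiFrdI2008, Thm. 3.4 (iv) p.63] -/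
theorem untrMap_isEquivalence (h₁ : PreservesUnitEquiv S₁ S₂ E.functor)
    (h₂ : PreservesUnitEquiv S₂ S₁ E.inverse) : (untrMap h₁).IsEquivalence :=
  (untrEquiv h₁ h₂).isEquivalence_functor

/-- **The first conjunct of `Thm34iv_untr`, hypothesis-decoupled**: for an equivalence `Ψ^istr : C₁^istr ≌ C₂^istr`
both of whose functors preserve unit-equivalence, `Ψ^un-tr` is an equivalence fitting into a `1`-commutative,
`1`-unique square with the quotient functors `C_i^istr → C_i^un-tr`. [cite: MochizukiFrdI2008, Thm. 3.4 (iv) p.63] -/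
theorem oneUniqueSquare_untrMap (h₁ : PreservesUnitEquiv S₁ S₂ E.functor)
    (h₂ : PreservesUnitEquiv S₂ S₁ E.inverse) : OneUniqueSquare E.functor S₁.toUntr S₂.toUntr (untrMap h₁) :=
  ⟨untrMap_isEquivalence h₁ h₂, oneCommutes_untrMap h₁, fun B' hB' => untrMap_unique h₁ B' hB'⟩

/-- The same packaged as the `∃ Ψuntr` of the typed statement (without the rigidity conjunct).
[cite: MochizukiFrdI2008, Thm. 3.4 (iv) p.63] -/
theorem exists_oneUniqueSquare_untr (h₁ : PreservesUnitEquiv S₁ S₂ E.functor)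
    (h₂ : PreservesUnitEquiv S₂ S₁ E.inverse) :
    ∃ Ψuntr : S₁.Untr ⥤ S₂.Untr, OneUniqueSquare E.functor S₁.toUntr S₂.toUntr Ψuntr :=
  ⟨untrMap h₁, oneUniqueSquare_untrMap h₁ h₂⟩

end Equivalence

end PreFrobenioidData

end Literature.AlgebraicGeometry.Frobenioids
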